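import Summits.AtomisticToContinuum.BoseEinsteinCondensation.Theorems.BECHardSphereReductionHardCoreDominatesMaxOccupationStability
import Summits.AtomisticToContinuum.BoseEinsteinCondensation.Theorems.BECHardSphereReductionHardCoreDominatesPathLsc
import Summits.AtomisticToContinuum.BoseEinsteinCondensation.Theorems.BECHardSphereReductionHardCoreDominatesDiniGlue
import HarnessLib

/-!
# BECHardSphereReduction / HardCoreDominates — the local-to-global reduction along the coupling path
# (line `birth`, skeleton v7: finite-coupling monotonicity ⇐ Dini sign, at each fixed `(v, R, N, L)`)

Crux `HardCoreDominates` (stmt-AtomisticToContinuum-11884) of route `BECHardSphereReduction`, line `birth`: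
the coupling path `v_t = v + t·1_{Iic R}` (`t : ℝ≥0`) from a pair potential `v` to the hard spheres.
The skeleton of record (`Cruxes/HardCoreDominates/Lines/birth.lean` v7) has ONE open stub, `stub_diniSign`
(the covariance sign in Dini form, in a dilute window). This file records, sorry-free and WITHOUT any window,
the pointwise reduction the skeleton performs at each fixed `(v, R, N, L)`:

* `maxOccupation_le_card` — `λ_max(γ_Ψ) ≤ N` for an admissible trial state (`γ_Ψ ≤ N`);
* `condensateNumber_le_card` — `condensateNumber w N L ≤ N` on an inhabited trial class (every slack level
  contains a near-minimiser); `condensateNumber_eq_top_of_isEmpty` — `= ⊤` on an empty one (`N ≥ 1`, `L ≤ 0`);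
* `antitone_coupling_of_dini` — if at `(v, R, N, L)` the upper-right Dini derivative of
  `t ↦ cn(v_t) := condensateNumber v_t N L` is `≤ 0` at every coupling `t` (`ε–h₀` form), then `t ↦ cn(v_t)` is
  antitone on `[0, ∞)`: the landed lower semicontinuity in `t` (`stub_pathLsc`, p154150) and the landed
  real-analysis glue (`stub_diniGlue`, p154590) applied to the finite path (`≤ N`, or constantly `⊤`);
* `pathDominated_of_dini` — in particular every point of the path is dominated by its start, `cn(v_t) ≤ cn(v)`,
  which with the landed lsc at the hard core (`stub_continuityAtHardCore`, p151033) is all the crux consumes;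
* `stub_localToGlobal` — the registered (closed-signature) form of `antitone_coupling_of_dini` used by the skeleton.

No physics enters: the sign hypothesis is explicit and local; nothing about `v`, `R`, `N`, `L` is assumed.
-/

noncomputable section

namespace Summit.AtomisticToContinuum.BoseEinsteinCondensation.Cruxes.HardCoreDominates.Birth

open Literature.MathematicalPhysics.QuantumManyBody.BoseGas
open scoped ENNReal NNReal

/-- `λ_max(γ_Ψ) ≤ N` for an admissible (normalised) trial state: `γ_Ψ ≤ N` as a quadratic form
(Cauchy–Schwarz in the contracted particle, `occupation_le_card_mul_lintegral_mul`). [cite: LSSY2005, §1.2 (1.18)] -/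
theorem maxOccupation_le_card {N : ℕ} {L : ℝ} (Ψ : TrialState N L) :
    maxOccupation N Ψ.ψ ≤ (N : ℝ≥0∞) := by
  refine iSup₂_le fun φ hφ => ?_
  calc occupation N φ Ψ.ψ
      ≤ (N : ℝ≥0∞) * (∫⁻ x, (‖φ x‖₊ : ℝ≥0∞) ^ 2) * ∫⁻ X, (‖Ψ.ψ X‖₊ : ℝ≥0∞) ^ 2 :=
        occupation_le_card_mul_lintegral_mul hφ.1.aemeasurable Ψ.contDiff.continuous.measurable
    _ = (N : ℝ≥0∞) := by rw [hφ.2, Ψ.norm_eq, mul_one, mul_one]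

/-- On an inhabited trial class the condensate number is at most `N`: every slack level `δ > 0` contains a
near-minimiser (`E₀ < E₀ + δ` if `E₀ < ⊤`, anything if `E₀ = ⊤`), whose `λ_max` is `≤ N`.
[cite: LSSY2005, §1.2 (1.18)–(1.19)] -/
theorem condensateNumber_le_card (w : ℝ → ℝ≥0∞) (N : ℕ) (L : ℝ) [hne : Nonempty (TrialState N L)] :
    condensateNumber w N L ≤ (N : ℝ≥0∞) := by
  refine iSup₂_le fun δ hδ => ?_
  by_cases htop : groundStateEnergy w N L = ⊤
  · obtain ⟨Ψ⟩ := hne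
    have hΨ : energy w Ψ ≤ groundStateEnergy w N L + δ := by
      rw [htop, top_add]
      exact le_top
    exact (iInf₂_le Ψ hΨ).trans (maxOccupation_le_card Ψ)
  · obtain ⟨Ψ, hΨ⟩ := iInf_lt_iff.1 (ENNReal.lt_add_right htop hδ.ne')
    exact (iInf₂_le Ψ hΨ.le).trans (maxOccupation_le_card Ψ)

/-- On an EMPTY trial class (`N ≥ 1` and `L ≤ 0`) the condensate number is `⊤` (an infimum over nothing, at the
slack level `δ = 1`). [folklore] -/
theorem condensateNumber_eq_top_of_isEmpty (w : ℝ → ℝ≥0∞) (N : ℕ) (L : ℝ) [h : IsEmpty (TrialState N L)] :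
    condensateNumber w N L = ⊤ := by
  refine le_antisymm le_top ?_
  refine le_iSup₂_of_le (f := fun δ (_ : (0 : ℝ≥0∞) < δ) =>
      ⨅ (Ψ : TrialState N L) (_ : energy w Ψ ≤ groundStateEnergy w N L + δ), maxOccupation N Ψ.ψ)
    1 one_pos ?_
  exact le_iInf fun Ψ => (h.false Ψ).elim

/-- **Local-to-global along the coupling path.** Fix `v`, `R`, `N`, `L` and put
`cn(t) := condensateNumber (v + t·1_{Iic R}) N L`. If the upper-right Dini derivative of `cn` is `≤ 0` at every
coupling — `∀ t, ∀ ε > 0, ∃ h₀ > 0, ∀ 0 < h ≤ h₀, cn(t + h) ≤ cn(t) + ε h` — then `cn` is antitone on `[0, ∞)`.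
Proof: `cn` is lower semicontinuous in `t` (`stub_pathLsc`) and finite (`≤ N` on an inhabited trial class; on an
empty one it is constantly `⊤` and there is nothing to prove), so the real-analysis glue `stub_diniGlue` applies.
[folklore] -/
theorem antitone_coupling_of_dini (v : ℝ → ℝ≥0∞) (R : ℝ) (N : ℕ) (L : ℝ)
    (hdini : ∀ (t : ℝ≥0) (ε : ℝ≥0), 0 < ε → ∃ h₀ : ℝ≥0, 0 < h₀ ∧ ∀ h : ℝ≥0, 0 < h → h ≤ h₀ →
      condensateNumber (v + Set.indicator (Set.Iic R) (fun _ : ℝ => (((t + h : ℝ≥0)) : ℝ≥0∞))) N L ≤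
        condensateNumber (v + Set.indicator (Set.Iic R) (fun _ : ℝ => (t : ℝ≥0∞))) N L + ((ε * h : ℝ≥0) : ℝ≥0∞))
    {s t : ℝ≥0} (hst : s ≤ t) :
    condensateNumber (v + Set.indicator (Set.Iic R) (fun _ : ℝ => (t : ℝ≥0∞))) N L ≤
      condensateNumber (v + Set.indicator (Set.Iic R) (fun _ : ℝ => (s : ℝ≥0∞))) N L := by
  cases isEmpty_or_nonempty (TrialState N L) with
  | inl hE =>
      rw [condensateNumber_eq_top_of_isEmpty (v + Set.indicator (Set.Iic R) (fun _ : ℝ => (s : ℝ≥0∞))) N L]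
      exact le_top
  | inr hNE =>
      set g : ℝ≥0 → ℝ≥0∞ := fun τ =>
        condensateNumber (v + Set.indicator (Set.Iic R) (fun _ : ℝ => (τ : ℝ≥0∞))) N L with hg
      have hfin : ∀ τ : ℝ≥0, g τ ≠ ⊤ := fun τ =>
        ne_top_of_le_ne_top (ENNReal.natCast_ne_top N) (condensateNumber_le_card _ N L)
      have hlsc : ∀ (τ₀ : ℝ≥0) (m : ℝ≥0∞), m < g τ₀ →
          ∃ ρ : ℝ≥0, 0 < ρ ∧ ∀ τ : ℝ≥0, τ₀ ≤ τ + ρ → τ ≤ τ₀ + ρ → m < g τ :=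
        fun τ₀ m hm => stub_pathLsc v R N L τ₀ m hm
      exact stub_diniGlue g hfin hlsc hdini s t hst

/-- **Path dominated by its start, from the Dini sign.** Under the same local hypothesis at `(v, R, N, L)`,
`condensateNumber (v + t·1_{Iic R}) N L ≤ condensateNumber v N L` for every finite coupling `t` — the form the
crux consumes (with the landed lower semicontinuity at the hard core). [folklore] -/
theorem pathDominated_of_dini (v : ℝ → ℝ≥0∞) (R : ℝ) (N : ℕ) (L : ℝ)
    (hdini : ∀ (t : ℝ≥0) (ε : ℝ≥0), 0 < ε → ∃ h₀ : ℝ≥0, 0 < h₀ ∧ ∀ h : ℝ≥0, 0 < h → h ≤ h₀ →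
      condensateNumber (v + Set.indicator (Set.Iic R) (fun _ : ℝ => (((t + h : ℝ≥0)) : ℝ≥0∞))) N L ≤
        condensateNumber (v + Set.indicator (Set.Iic R) (fun _ : ℝ => (t : ℝ≥0∞))) N L + ((ε * h : ℝ≥0) : ℝ≥0∞))
    (t : ℝ≥0) :
    condensateNumber (v + Set.indicator (Set.Iic R) (fun _ : ℝ => (t : ℝ≥0∞))) N L ≤
      condensateNumber v N L := by
  have h := antitone_coupling_of_dini v R N L hdini (s := 0) (t := t) bot_le
  have hv₀ : (v + Set.indicator (Set.Iic R) (fun _ : ℝ => (((0 : ℝ≥0) : ℝ≥0∞)))) = v := by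
    funext r
    simp
  rwa [hv₀] at h

/-- **stub — LocalToGlobal (registered form of `antitone_coupling_of_dini`).** At each fixed `(v, R, N, L)`: a
non-positive upper-right Dini derivative of `t ↦ condensateNumber (v + t·1_{Iic R}) N L` at every coupling makes the
path antitone on `[0, ∞)` — lower semicontinuity in `t` (`stub_pathLsc`) plus the real-analysis glue
(`stub_diniGlue`) on the finite path. This is the window-free part of the line's composition; the skeleton applies
it inside the dilute window of the open stub `stub_diniSign`. [folklore] -/
theorem stub_localToGlobal :
    ∀ (v : ℝ → ENNReal) (R : ℝ) (N : ℕ) (L : ℝ),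
      (∀ (t : NNReal) (ε : NNReal), 0 < ε → ∃ h₀ : NNReal, 0 < h₀ ∧ ∀ h : NNReal, 0 < h → h ≤ h₀ →
        Literature.MathematicalPhysics.QuantumManyBody.BoseGas.condensateNumber
            (v + Set.indicator (Set.Iic R) (fun _ : ℝ => (((t + h : NNReal)) : ENNReal))) N L ≤
          Literature.MathematicalPhysics.QuantumManyBody.BoseGas.condensateNumber
            (v + Set.indicator (Set.Iic R) (fun _ : ℝ => (t : ENNReal))) N L + ((ε * h : NNReal) : ENNReal)) →
      ∀ s t : NNReal, s ≤ t →
        Literature.MathematicalPhysics.QuantumManyBody.BoseGas.condensateNumber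
            (v + Set.indicator (Set.Iic R) (fun _ : ℝ => (t : ENNReal))) N L ≤
          Literature.MathematicalPhysics.QuantumManyBody.BoseGas.condensateNumber
            (v + Set.indicator (Set.Iic R) (fun _ : ℝ => (s : ENNReal))) N L :=
  fun v R N L hdini _s _t hst => antitone_coupling_of_dini v R N L hdini hst

end Summit.AtomisticToContinuum.BoseEinsteinCondensation.Cruxes.HardCoreDominates.Birth

end
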